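import Summits.BirchSwinnertonDyer.BirchSwinnertonDyer.Theorems.KolyvaginDepthDoorDepthTableRowsExactReading944e1
import Literature.NumberTheory.EllipticCurves.HondaStrongIsomorphismMultiplicativeProofs
import HarnessLib

/-!
# Route `KolyvaginDepthDoor`, crux `KolyvaginDepthSupplyKN` (stmt-BirchSwinnertonDyer-22820) —
# DEPTH TABLE v25, CERTIFICATE KIT: Kim's hypothesis (iv) `p ∤ ∏ c_v` IN ITS EXACT PRINTED FORM from the
# integer model — `p ∤ ord_v(Δ_min)` at the SPLIT multiplicative places only, the non-split ones being
# certified by Euler's criterion on the node-tangent discriminant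

Helper file of the lead prover of line `levelone` (kdd-p1 g29; `--supports stmt-BirchSwinnertonDyer-22820
--as helper`); it closes nothing and BSD is NOT proved by it. Pure kernel plumbing (no named fact).

WHY. The rows of the depth table feed Kim's hypothesis (iv) «all Tamagawa factors prime to `p`» through
the crux's Kodaira–Néron clause `∀ v multiplicative, p ∤ ord_v(Δ_min)` (`not_dvd_tamagawaProduct_of_kodairaNeron`).
At a NON-SPLIT multiplicative place `c_v ∈ {1, 2}` whatever `ord_v(Δ_min)` is (Kodaira–Néron), so the
clause is stronger than (iv): 494 of the 61 209 depth-two unit records of rank-two curves (census g29) have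
`p ∣ ord_q(Δ_min)` only at non-split `q` — inside Kim's (iv), outside the clause as typed. v25's generic
`sha_inf_torsionBy_eq_bot_of_kuriharaClaim_of_hasGoodReduction_int` takes (iv) from the SPLIT places
(`not_dvd_tamagawaProduct_of_splitKodairaNeron` = the tree's `CornerLocal.not_dvd_tamagawaProduct_iff_forall`);
this file supplies the per-curve certificate: the table lemma of `…RowsExactReading944e1`
(`not_dvd_ordMinimalDiscriminant_of_intModel_table_additive`) with a THIRD kind of table entry — a prime
`q ∣ Δ` at which the node-tangent quadratic `c₄T² + a₁c₄T − (54b₆ − 3b₂b₄ + a₂c₄)` of the integer model has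
a NON-SQUARE discriminant mod `q` (Euler: `d^{(q−1)/2} = −1`), so the reduction is non-split (tree
`hasSplitMultiplicativeReductionAt_iff_splits`, Silverman VII.5.1 (b)) and the place is exempt.

* `not_hasSplitMultiplicativeReductionAt_of_euler` — non-split from Euler's criterion at an odd `q ∣ Δ`, `q ∤ c₄`;
* `not_dvd_ordMinimalDiscriminant_split_of_intModel_table` — the split-place table lemma.

References: [SilvermanAEC2009] VII.5 Prop. 5.1 (b), (c), VII.1 Prop. 1.3 (b), VIII.8; [SilvermanATAEC1994] Cor.
IV.9.2 (d); [Kim2022StructureSelmer] Thm. 1.11 hypothesis (iv).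
-/

set_option linter.dupNamespace false

noncomputable section

open scoped Classical NumberField

namespace Summit.BirchSwinnertonDyer.BirchSwinnertonDyer.Theorems.KolyvaginDepthDoor

open Literature.NumberTheory.EllipticCurves WeierstrassCurve NumberField IsDedekindDomain Polynomial
open Summit.BirchSwinnertonDyer.BirchSwinnertonDyer.Theorems

section SplitKodairaNeron

variable {W : WeierstrassCurve ℚ} [W.IsElliptic] [W.IsGloballyMinimal]

/-- **Non-split multiplicative reduction from Euler's criterion.** `integralModelInt W = E₀`; `v` the place
over an odd prime `q` with `q ∣ Δ(E₀)`, `q ∤ c₄(E₀)` (multiplicative); if the discriminant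
`d = (a₁c₄)² + 4c₄(54b₆ − 3b₂b₄ + a₂c₄)` of the node-tangent quadratic satisfies `d^{(q−1)/2} = −1` in
`ℤ/q`, the quadratic has no root mod `q`, so `W` is NOT split multiplicative at `v` (the tree's
`hasSplitMultiplicativeReductionAt_iff_splits`). [cite: SilvermanAEC2009, VII.5 Prop. 5.1 (b) and VII.1 Prop. 1.3 (b)] -/
theorem not_hasSplitMultiplicativeReductionAt_of_euler {E₀ : WeierstrassCurve ℤ}
    (hI : integralModelInt W = E₀) (v : HeightOneSpectrum (𝓞 ℚ)) {d₀ : ℤ}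
    (hd : (E₀.a₁ * E₀.c₄) ^ 2 + 4 * E₀.c₄ * (54 * E₀.b₆ - 3 * E₀.b₂ * E₀.b₄ + E₀.a₂ * E₀.c₄) = d₀)
    (hΔ : ((Rat.HeightOneSpectrum.primesEquiv v : ℕ) : ℤ) ∣ E₀.Δ)
    (hc₄ : ¬ ((Rat.HeightOneSpectrum.primesEquiv v : ℕ) : ℤ) ∣ E₀.c₄)
    (h2 : (Rat.HeightOneSpectrum.primesEquiv v : ℕ) ≠ 2)
    (heuler : ((d₀ : ℤ) : ZMod (Rat.HeightOneSpectrum.primesEquiv v : ℕ)) ^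
      ((Rat.HeightOneSpectrum.primesEquiv v : ℕ) / 2) = -1) :
    ¬ W.HasSplitMultiplicativeReductionAt v := by
  set q : ℕ := (Rat.HeightOneSpectrum.primesEquiv v : ℕ) with hq
  have hqP : q.Prime := (Rat.HeightOneSpectrum.primesEquiv v).2
  haveI : Fact q.Prime := ⟨hqP⟩
  haveI : Fact (2 < q) := ⟨lt_of_le_of_ne hqP.two_le (Ne.symm h2)⟩
  have hΔ' : (q : ℤ) ∣ minimalDiscriminantInt W := by
    rw [WeierstrassCurve.minimalDiscriminantInt, hI]; exact hΔ
  have hc₄' : ¬ (q : ℤ) ∣ (integralModelInt W).c₄ := by rw [hI]; exact hc₄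
  rw [hasSplitMultiplicativeReductionAt_iff_splits W v hΔ' hc₄', hI]
  intro hs
  obtain ⟨t, ht⟩ := hs.exists_eval_eq_zero
    (by rw [Rank1Residual.IntModel.degree_nodal_eq_two E₀ _ hc₄]; decide)
  simp only [eval_sub, eval_add, eval_mul, eval_C, eval_X, eval_pow, map_c₄, map_b₂, map_b₄,
    map_b₆, map_a₁, map_a₂, eq_intCast] at ht
  have hsq : IsSquare ((d₀ : ℤ) : ZMod q) := by
    refine ⟨2 * (E₀.c₄ : ZMod q) * t + (E₀.a₁ * E₀.c₄ : ℤ), ?_⟩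
    have hdisc := discrim_eq_sq_of_quadratic_eq_zero (a := (E₀.c₄ : ZMod q))
      (b := ((E₀.a₁ * E₀.c₄ : ℤ) : ZMod q))
      (c := -((54 * E₀.b₆ - 3 * E₀.b₂ * E₀.b₄ + E₀.a₂ * E₀.c₄ : ℤ) : ZMod q))
      (x := t) (by push_cast; linear_combination ht)
    rw [discrim] at hdisc
    rw [← hd]
    push_cast at hdisc ⊢
    linear_combination hdisc
  have hne : ((d₀ : ℤ) : ZMod q) ≠ 0 := by
    intro h0
    rw [h0, zero_pow (Nat.div_pos hqP.two_le two_pos).ne'] at heuler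
    exact one_ne_zero (neg_eq_zero.mp heuler.symm)
  rw [ZMod.euler_criterion q hne] at hsq
  rw [hsq] at heuler
  exact ZMod.neg_one_ne_one heuler.symm

/-- **(KN_p) at the SPLIT places from the integer model — Kim's hypothesis (iv) exactly.** With
`integralModelInt W = E₀`, `Δ(E₀) = Δ₀`, `c₄(E₀) = c₀`, the node-tangent discriminant `d₀`, `|Δ₀| < B^p`, a
list `ns` of odd primes at which `d₀` is a non-residue (Euler), and a table saying that every prime `q < B`
dividing `Δ₀` either divides `c₀` (ADDITIVE — no multiplicative place over it), or lies in `ns` (NON-SPLIT —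
exempt), or has `q^e ∥ Δ₀` with `p ∤ e`: then `p ∤ ord_v(Δ_min)` at every SPLIT multiplicative place `v`,
which is `p ∤ ∏_v c_v` (`not_dvd_tamagawaProduct_of_splitKodairaNeron`). All tables `decide`-able.
[cite: SilvermanAEC2009, VII.5 Prop. 5.1 (b), (c), VIII.8] [cite: SilvermanATAEC1994, Cor. IV.9.2 (d)] -/
theorem not_dvd_ordMinimalDiscriminant_split_of_intModel_table {E₀ : WeierstrassCurve ℤ}
    (hI : integralModelInt W = E₀) {p : ℕ} {Δ₀ c₀ d₀ : ℤ} (hΔ : E₀.Δ = Δ₀) (hc : E₀.c₄ = c₀)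
    (hd : (E₀.a₁ * E₀.c₄) ^ 2 + 4 * E₀.c₄ * (54 * E₀.b₆ - 3 * E₀.b₂ * E₀.b₄ + E₀.a₂ * E₀.c₄) = d₀)
    {B : ℕ} (hB : Δ₀.natAbs < B ^ p) (ns : List ℕ)
    (hns : ∀ q ∈ ns, q ≠ 2 ∧ ((d₀ : ℤ) : ZMod q) ^ (q / 2) = -1)
    (htab : ∀ q ∈ Finset.range B, q.Prime → q ∣ Δ₀.natAbs → (q : ℤ) ∣ c₀ ∨ q ∈ ns ∨
      ∃ e ∈ Finset.range 64, q ^ e ∣ Δ₀.natAbs ∧ ¬ q ^ (e + 1) ∣ Δ₀.natAbs ∧ ¬ p ∣ e)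
    (v : HeightOneSpectrum (𝓞 ℚ)) (hv : W.HasSplitMultiplicativeReductionAt v) :
    ¬ p ∣ W.ordMinimalDiscriminant v := by
  set q := Rat.HeightOneSpectrum.natGenerator v with hq
  have hqP : q.Prime := Rat.HeightOneSpectrum.prime_natGenerator v
  haveI : Fact q.Prime := ⟨hqP⟩
  have hvm : W.HasMultiplicativeReductionAt v := hv.hasMultiplicativeReductionAt
  -- `ord_v(Δ_min) = v_q(Δ₀)`
  have hord : W.ordMinimalDiscriminant v = padicValNat q Δ₀.natAbs := by
    rw [ordMinimalDiscriminant_eq_padicValInt_natGenerator_ringOfIntegers v, padicValInt,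
      WeierstrassCurve.minimalDiscriminantInt, hI, hΔ]
  have hne : W.ordMinimalDiscriminant v ≠ 0 := fun h0 ↦
    hvm.not_hasGoodReductionAt ((W.ordMinimalDiscriminant_eq_zero_iff_holds v).mp h0)
  rw [hord] at hne ⊢
  set n := Δ₀.natAbs with hn
  have hn0 : n ≠ 0 := by
    intro h0
    rw [h0, padicValNat_zero_right] at hne
    exact hne rfl
  have hk1 : 1 ≤ padicValNat q n := Nat.one_le_iff_ne_zero.mpr hne
  have hqn : q ∣ n := dvd_of_one_le_padicValNat hk1
  have hqk : q ^ padicValNat q n ∣ n := pow_padicValNat_dvd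
  -- the two ways a table entry exempts `q`: additive, or non-split
  have hqΔ : ((Rat.HeightOneSpectrum.primesEquiv v : ℕ) : ℤ) ∣ E₀.Δ := by
    show (q : ℤ) ∣ E₀.Δ
    rw [hΔ, ← Int.natAbs_dvd_natAbs, Int.natAbs_natCast]
    exact hqn
  have hadd : ¬ (q : ℤ) ∣ c₀ := by
    intro hqc
    have hΔ' : ((Rat.HeightOneSpectrum.primesEquiv v : ℕ) : ℤ) ∣ minimalDiscriminantInt W := by
      rw [WeierstrassCurve.minimalDiscriminantInt, hI]; exact hqΔ
    have hc₄' : ((Rat.HeightOneSpectrum.primesEquiv v : ℕ) : ℤ) ∣ (integralModelInt W).c₄ := by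
      show (q : ℤ) ∣ (integralModelInt W).c₄
      rw [hI, hc]
      exact hqc
    exact (W.hasAdditiveReductionAt_of_dvd_of_dvd v hΔ' hc₄').not_hasMultiplicativeReductionAt hvm
  have hnotns : q ∉ ns := by
    intro hmem
    obtain ⟨h2, heu⟩ := hns q hmem
    have hc₄' : ¬ ((Rat.HeightOneSpectrum.primesEquiv v : ℕ) : ℤ) ∣ E₀.c₄ := by
      show ¬ (q : ℤ) ∣ E₀.c₄
      rw [hc]; exact hadd
    exact not_hasSplitMultiplicativeReductionAt_of_euler hI v hd hqΔ hc₄' h2 heu hv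
  by_cases hqB : q < B
  · rcases htab q (Finset.mem_range.mpr hqB) hqP hqn with hqc | hmem | ⟨e, -, he, he1, hpe⟩
    · exact absurd hqc hadd
    · exact absurd hmem hnotns
    · have hle : e ≤ padicValNat q n := (padicValNat_dvd_iff_le hn0).mp he
      have hlt : ¬ e + 1 ≤ padicValNat q n := fun h ↦ he1 ((padicValNat_dvd_iff_le hn0).mpr h)
      have heq : padicValNat q n = e := by omega
      rwa [heq]
  · -- `q ≥ B`: `q ^ v_q(n) ≤ n < B ^ p ≤ q ^ p`, so `1 ≤ v_q(n) < p`
    push Not at hqB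
    have hle : q ^ padicValNat q n ≤ n := Nat.le_of_dvd (Nat.pos_of_ne_zero hn0) hqk
    have hBq : B ^ p ≤ q ^ p := Nat.pow_le_pow_left hqB p
    have hlt : q ^ padicValNat q n < q ^ p := lt_of_le_of_lt hle (lt_of_lt_of_le hB hBq)
    have hkp : padicValNat q n < p := (Nat.pow_lt_pow_iff_right hqP.one_lt).mp hlt
    intro hdvd
    exact absurd (Nat.le_of_dvd hk1 hdvd) (not_le.mpr hkp)

/-! ### No-root certificates (any prime `q`, including `q = 2`) -/

/-- **Non-split multiplicative reduction from a NO-ROOT certificate** (any prime `q`, also `q = 2` where Euler's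
criterion is not available): `integralModelInt W = E₀`, `q ∣ Δ(E₀)`, `q ∤ c₄(E₀)`, and the node-tangent quadratic
`c₀T² + a₀T − k₀` (`c₀ = c₄`, `a₀ = a₁c₄`, `k₀ = 54b₆ − 3b₂b₄ + a₂c₄` of `E₀`) has no root among `t = 0, …, q − 1`
(integer congruences, `decide`-able) ⟹ `W` is NOT split multiplicative at the place over `q`.
[cite: SilvermanAEC2009, VII.5 Prop. 5.1 (b) and VII.1 Prop. 1.3 (b)] -/
theorem not_hasSplitMultiplicativeReductionAt_of_noRoot {E₀ : WeierstrassCurve ℤ}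
    (hI : integralModelInt W = E₀) (v : HeightOneSpectrum (𝓞 ℚ)) {c₀ a₀ k₀ : ℤ} (hc : E₀.c₄ = c₀)
    (ha : E₀.a₁ * E₀.c₄ = a₀) (hk : 54 * E₀.b₆ - 3 * E₀.b₂ * E₀.b₄ + E₀.a₂ * E₀.c₄ = k₀)
    (hΔ : ((Rat.HeightOneSpectrum.primesEquiv v : ℕ) : ℤ) ∣ E₀.Δ)
    (hc₄ : ¬ ((Rat.HeightOneSpectrum.primesEquiv v : ℕ) : ℤ) ∣ E₀.c₄)
    (hnr : ∀ t : ℕ, t < (Rat.HeightOneSpectrum.primesEquiv v : ℕ) →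
      ¬ ((Rat.HeightOneSpectrum.primesEquiv v : ℕ) : ℤ) ∣ c₀ * t ^ 2 + a₀ * t - k₀) :
    ¬ W.HasSplitMultiplicativeReductionAt v := by
  set q : ℕ := (Rat.HeightOneSpectrum.primesEquiv v : ℕ) with hq
  have hqP : q.Prime := (Rat.HeightOneSpectrum.primesEquiv v).2
  haveI : Fact q.Prime := ⟨hqP⟩
  haveI : NeZero q := ⟨hqP.ne_zero⟩
  have hΔ' : (q : ℤ) ∣ minimalDiscriminantInt W := by
    rw [WeierstrassCurve.minimalDiscriminantInt, hI]; exact hΔ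
  have hc₄' : ¬ (q : ℤ) ∣ (integralModelInt W).c₄ := by rw [hI]; exact hc₄
  rw [hasSplitMultiplicativeReductionAt_iff_splits W v hΔ' hc₄', hI]
  intro hs
  obtain ⟨t, ht⟩ := hs.exists_eval_eq_zero
    (by rw [Rank1Residual.IntModel.degree_nodal_eq_two E₀ _ hc₄]; decide)
  simp only [eval_sub, eval_add, eval_mul, eval_C, eval_X, eval_pow, map_c₄, map_b₂, map_b₄,
    map_b₆, map_a₁, map_a₂, eq_intCast] at ht
  refine hnr t.val (ZMod.val_lt t) ?_
  rw [← ZMod.intCast_zmod_eq_zero_iff_dvd]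
  push_cast
  rw [ZMod.natCast_zmod_val, ← hc, ← ha, ← hk]
  push_cast
  linear_combination ht

/-- **(KN_p) at the SPLIT places from the integer model, no-root form of the exemptions** (any offending prime,
including `2`): as `not_dvd_ordMinimalDiscriminant_split_of_intModel_table`, the list `ns` of NON-SPLIT exempt
primes being certified by «the node-tangent quadratic `c₀T² + a₀T − k₀` has no root mod `q`» (`decide` on integer
congruences, `t < q`) instead of Euler's criterion. [cite: SilvermanAEC2009, VII.5 Prop. 5.1 (b), (c), VIII.8]
[cite: SilvermanATAEC1994, Cor. IV.9.2 (d)] -/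
theorem not_dvd_ordMinimalDiscriminant_split_of_intModel_table_noRoot {E₀ : WeierstrassCurve ℤ}
    (hI : integralModelInt W = E₀) {p : ℕ} {Δ₀ c₀ a₀ k₀ : ℤ} (hΔ : E₀.Δ = Δ₀) (hc : E₀.c₄ = c₀)
    (ha : E₀.a₁ * E₀.c₄ = a₀) (hk : 54 * E₀.b₆ - 3 * E₀.b₂ * E₀.b₄ + E₀.a₂ * E₀.c₄ = k₀)
    {B : ℕ} (hB : Δ₀.natAbs < B ^ p) (ns : List ℕ)
    (hns : ∀ q ∈ ns, ∀ t : ℕ, t < q → ¬ ((q : ℤ) ∣ c₀ * t ^ 2 + a₀ * t - k₀))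
    (htab : ∀ q ∈ Finset.range B, q.Prime → q ∣ Δ₀.natAbs → (q : ℤ) ∣ c₀ ∨ q ∈ ns ∨
      ∃ e ∈ Finset.range 64, q ^ e ∣ Δ₀.natAbs ∧ ¬ q ^ (e + 1) ∣ Δ₀.natAbs ∧ ¬ p ∣ e)
    (v : HeightOneSpectrum (𝓞 ℚ)) (hv : W.HasSplitMultiplicativeReductionAt v) :
    ¬ p ∣ W.ordMinimalDiscriminant v := by
  set q := Rat.HeightOneSpectrum.natGenerator v with hq
  have hqP : q.Prime := Rat.HeightOneSpectrum.prime_natGenerator v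
  haveI : Fact q.Prime := ⟨hqP⟩
  have hvm : W.HasMultiplicativeReductionAt v := hv.hasMultiplicativeReductionAt
  have hord : W.ordMinimalDiscriminant v = padicValNat q Δ₀.natAbs := by
    rw [ordMinimalDiscriminant_eq_padicValInt_natGenerator_ringOfIntegers v, padicValInt,
      WeierstrassCurve.minimalDiscriminantInt, hI, hΔ]
  have hne : W.ordMinimalDiscriminant v ≠ 0 := fun h0 ↦
    hvm.not_hasGoodReductionAt ((W.ordMinimalDiscriminant_eq_zero_iff_holds v).mp h0)
  rw [hord] at hne ⊢
  set n := Δ₀.natAbs with hn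
  have hn0 : n ≠ 0 := by
    intro h0
    rw [h0, padicValNat_zero_right] at hne
    exact hne rfl
  have hk1 : 1 ≤ padicValNat q n := Nat.one_le_iff_ne_zero.mpr hne
  have hqn : q ∣ n := dvd_of_one_le_padicValNat hk1
  have hqk : q ^ padicValNat q n ∣ n := pow_padicValNat_dvd
  have hqΔ : ((Rat.HeightOneSpectrum.primesEquiv v : ℕ) : ℤ) ∣ E₀.Δ := by
    show (q : ℤ) ∣ E₀.Δ
    rw [hΔ, ← Int.natAbs_dvd_natAbs, Int.natAbs_natCast]
    exact hqn
  have hadd : ¬ (q : ℤ) ∣ c₀ := by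
    intro hqc
    have hΔ' : ((Rat.HeightOneSpectrum.primesEquiv v : ℕ) : ℤ) ∣ minimalDiscriminantInt W := by
      rw [WeierstrassCurve.minimalDiscriminantInt, hI]; exact hqΔ
    have hc₄' : ((Rat.HeightOneSpectrum.primesEquiv v : ℕ) : ℤ) ∣ (integralModelInt W).c₄ := by
      show (q : ℤ) ∣ (integralModelInt W).c₄
      rw [hI, hc]
      exact hqc
    exact (W.hasAdditiveReductionAt_of_dvd_of_dvd v hΔ' hc₄').not_hasMultiplicativeReductionAt hvm
  have hnotns : q ∉ ns := by
    intro hmem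
    have hc₄' : ¬ ((Rat.HeightOneSpectrum.primesEquiv v : ℕ) : ℤ) ∣ E₀.c₄ := by
      show ¬ (q : ℤ) ∣ E₀.c₄
      rw [hc]; exact hadd
    exact not_hasSplitMultiplicativeReductionAt_of_noRoot hI v hc ha hk hqΔ hc₄' (hns q hmem) hv
  by_cases hqB : q < B
  · rcases htab q (Finset.mem_range.mpr hqB) hqP hqn with hqc | hmem | ⟨e, -, he, he1, hpe⟩
    · exact absurd hqc hadd
    · exact absurd hmem hnotns
    · have hle : e ≤ padicValNat q n := (padicValNat_dvd_iff_le hn0).mp he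
      have hlt : ¬ e + 1 ≤ padicValNat q n := fun h ↦ he1 ((padicValNat_dvd_iff_le hn0).mpr h)
      have heq : padicValNat q n = e := by omega
      rwa [heq]
  · push Not at hqB
    have hle : q ^ padicValNat q n ≤ n := Nat.le_of_dvd (Nat.pos_of_ne_zero hn0) hqk
    have hBq : B ^ p ≤ q ^ p := Nat.pow_le_pow_left hqB p
    have hlt : q ^ padicValNat q n < q ^ p := lt_of_le_of_lt hle (lt_of_lt_of_le hB hBq)
    have hkp : padicValNat q n < p := (Nat.pow_lt_pow_iff_right hqP.one_lt).mp hlt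
    intro hdvd
    exact absurd (Nat.le_of_dvd hk1 hdvd) (not_le.mpr hkp)

end SplitKodairaNeron

end Summit.BirchSwinnertonDyer.BirchSwinnertonDyer.Theorems.KolyvaginDepthDoor

end
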